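import Summits.QuantumFields.YangMills.Theorems.BalabanUVNodesN15KingModelTransferOperatorExactGap
import Summits.QuantumFields.YangMills.Theorems.BalabanUVNodesN15KingModelMasslessTransferOperatorGapless
import Summits.QuantumFields.YangMills.Theorems.BalabanUVNodesN15KingModelOSClusteringRateSharp

/-!
# BalabanUVNodes ∕ N15 — THE KING-MODEL RUNG: PART Ͳ (tav) PACKAGE — the Osterwalder–Schrader reconstruction, the exact mass gap and the sharp clustering rate of King's massive
# infinite-volume block field, and the gapless Osterwalder–Schrader reconstruction of the massless (critical) block field, BY NAME, in one conjunction
# (Track A, DAG node N15 = NE2; FAN-OUT v1.1 §N15 s3 «KING-MODEL RUNG»; count-neutral)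

HONEST FRAMING.  Count-neutral (cell `pub-ymgap`, seat `pub-ymgap-dag-n15-e` g36; `--supports stmt-QuantumFields-27366 --as helper` = K3⁸).  King's `A = 0`, `g = 0` model
([King1986] C. King, Commun. Math. Phys. **102** (1986) 649–677); index theorem of parts Ͳ-c₁…Ͳ-g (files 352–363), every conjunct a headline BY NAME in the tree's lattice
Osterwalder–Schrader vocabulary (`IsReflectionPositive`, `IsRPMeasureData`, `IsOSRealisation`, `TransferData.HasMassGap ∕ gapNorm ∕ massGap`, `HasTimeClustering`).  FREE fields: the massive
gap is the input mass `√m²`, the critical field is gapless; NOT Bałaban's objects; NOT a node discharge; nothing about Yang–Mills ∕ continuum ∕ `ℝ⁴` ∕ Clay.  0 `sorry`, 0 def.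

WHAT THIS FILE PROVES (kernel).  ★★★ **`king_os_package`** (massive, every `d`, `m² > 0`), ★★★ **`king0_os_package`** (massless, `d + 1 ≥ 3`).
-/

noncomputable section

open scoped BigOperators
open MeasureTheory ProbabilityTheory Finset

namespace Summit.QuantumFields.YangMills.BalabanUVNodes.N15KingModelRung.InfiniteVolume

open Literature.MathematicalPhysics.QuantumFieldTheory (latticeTimeReflection positiveTimeSites positiveTimeEvents latticeTimeShift)
open Literature.Probability.LatticeModels (configReflect IsReflectionPositive IsRPMeasureData IsOSRealisation TransferData HasTimeClustering rpMap rpTransferData)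

variable {d : ℕ}

/-- ★★★ **PART Ͳ PACKAGE, MASSIVE FIELD** (`m² > 0`, every `d`): King's infinite-volume block field `μ_∞` is reflection positive on all bounded positive-time observables, is an
`IsRPMeasureData`, is REALISED by the tree's Osterwalder–Schrader reconstruction, whose transfer operator has gap norm EXACTLY `e^{−√m²}` (mass gap `√m²`, `HasMassGap m′ ↔ 0 < m′ ≤ √m²`),
and `μ_∞` clusters exponentially in time at rate `√m²` on all bounded positive-time observables and at no larger rate. [cite: King1986, Thm 2.1 (2.22)–(2.23) p.654, Thm 3.3 (3.6) p.656; GlimmJaffe1987, §6.1 Thm. 6.1.3, §6.2 Thm. 6.2.2, §19.7 Thm. 19.7.1; OsterwalderSeiler1978, §2] -/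
theorem king_os_package {m2 : ℝ} (hm : 0 < m2) :
    IsReflectionPositive (kingFieldInf (d := d) m2) (latticeTimeReflection (d + 1)) (positiveTimeSites (d + 1))
    ∧ IsRPMeasureData (kingFieldInf (d := d) m2) (configReflect (latticeTimeReflection (d + 1))) (latticeTimeShift (d + 1) ℝ) (positiveTimeEvents (d + 1) ℝ)
    ∧ IsOSRealisation (kingFieldInf (d := d) m2) (configReflect (latticeTimeReflection (d + 1))) (latticeTimeShift (d + 1) ℝ) (positiveTimeEvents (d + 1) ℝ)
        (rpMap (king_isRPMeasureData hm)) (rpTransferData (king_isRPMeasureData hm) (king_shift_nonneg hm))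
    ∧ (rpTransferData (king_isRPMeasureData (d := d) hm) (king_shift_nonneg hm)).gapNorm = Real.exp (-Real.sqrt m2)
    ∧ (rpTransferData (king_isRPMeasureData (d := d) hm) (king_shift_nonneg hm)).massGap = ((Real.sqrt m2 : ℝ) : EReal)
    ∧ (∀ m' : ℝ, (rpTransferData (king_isRPMeasureData (d := d) hm) (king_shift_nonneg hm)).HasMassGap m' ↔ 0 < m' ∧ m' ≤ Real.sqrt m2)
    ∧ HasTimeClustering (kingFieldInf (d := d) m2) (configReflect (latticeTimeReflection (d + 1))) (latticeTimeShift (d + 1) ℝ) (positiveTimeEvents (d + 1) ℝ) (Real.sqrt m2)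
    ∧ (∀ m' : ℝ, Real.sqrt m2 < m' →
        ¬ HasTimeClustering (kingFieldInf (d := d) m2) (configReflect (latticeTimeReflection (d + 1))) (latticeTimeShift (d + 1) ℝ) (positiveTimeEvents (d + 1) ℝ) m') :=
  ⟨king_isReflectionPositive hm, king_isRPMeasureData hm, king_isOSRealisation hm, king_gapNorm_eq hm, king_massGap_eq hm, king_hasMassGap_iff hm,
    king_hasTimeClustering hm, fun _ hm' => king_not_hasTimeClustering_of_gt hm hm'⟩

/-- ★★★ **PART Ͳ PACKAGE, MASSLESS FIELD** (`d + 1 ≥ 3`): the critical block field `μ⁰_∞` (the block-spin RG fixed point) is reflection positive on all bounded positive-time observables,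
an `IsRPMeasureData`, REALISED by the tree's Osterwalder–Schrader reconstruction — and GAPLESS: gap norm `1`, mass gap `0`, no `HasMassGap m`, no exponential time clustering at any rate.
[cite: King1986, Thm 2.1 (2.22) p.654, (4.5) p.670; GlimmJaffe1987, §6.1 Thm. 6.1.3, §19.7 Thm. 19.7.1; OsterwalderSeiler1978, §2] -/
theorem king0_os_package (hd : 2 ≤ d) :
    IsReflectionPositive (kingFieldInf0 d) (latticeTimeReflection (d + 1)) (positiveTimeSites (d + 1))
    ∧ IsRPMeasureData (kingFieldInf0 d) (configReflect (latticeTimeReflection (d + 1))) (latticeTimeShift (d + 1) ℝ) (positiveTimeEvents (d + 1) ℝ)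
    ∧ IsOSRealisation (kingFieldInf0 d) (configReflect (latticeTimeReflection (d + 1))) (latticeTimeShift (d + 1) ℝ) (positiveTimeEvents (d + 1) ℝ)
        (rpMap (king0_isRPMeasureData hd)) (rpTransferData (king0_isRPMeasureData hd) (king0_shift_nonneg hd))
    ∧ (rpTransferData (king0_isRPMeasureData (d := d) hd) (king0_shift_nonneg hd)).gapNorm = 1
    ∧ (rpTransferData (king0_isRPMeasureData (d := d) hd) (king0_shift_nonneg hd)).massGap = 0
    ∧ (∀ m : ℝ, ¬ (rpTransferData (king0_isRPMeasureData (d := d) hd) (king0_shift_nonneg hd)).HasMassGap m)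
    ∧ (∀ m : ℝ, 0 < m →
        ¬ HasTimeClustering (kingFieldInf0 d) (configReflect (latticeTimeReflection (d + 1))) (latticeTimeShift (d + 1) ℝ) (positiveTimeEvents (d + 1) ℝ) m) :=
  ⟨king0_isReflectionPositive hd, king0_isRPMeasureData hd, king0_isOSRealisation hd, king0_gapNorm_eq_one hd, king0_massGap_eq_zero hd, king0_not_hasMassGap hd,
    fun _ hm => king0_not_hasTimeClustering hd hm⟩

end Summit.QuantumFields.YangMills.BalabanUVNodes.N15KingModelRung.InfiniteVolume
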